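import Summits.SmoothPoincare4.SmoothPoincare4.Theses.SymplecticOrigami
import Literature.Topology.FourManifolds.HomotopySpheres
import Literature.Topology.FourManifolds.ImmersionOrientation

/-!
# `OrigamiFoldExistence`, line `round-trace-continuity`: the crease germ of an immersed fake ball
# (negative-side support for `stub_meanConvexUnwinding`, crux stmt-SmoothPoincare4-7844)

The picked skeleton `Cruxes/OrigamiFoldExistence/Lines/round-trace-continuity.lean` studies a
homotopy 4-sphere `S` through IMMERSED FAKE BALLS `(e, F)`: `e : ℝ⁴ → S` a smooth embedding,
`F : S → ℝ⁴` a `C^∞` local diffeomorphism at every point outside `e(B̊⁴)`; the CREASE GERM is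
`F ∘ e : ℝ⁴ → ℝ⁴` near the unit sphere.  Its hardest stub `stub_meanConvexUnwinding` (PATH) asks
for a family `g t` with `g 0 = F ∘ e` satisfying `IsMeanConvexUnwinding g c r`, whose `t = 0`
clauses demand `ContDiffAt ℝ ∞` of the germ and bijectivity of its `fderiv` at every unit vector.
This file kernel-checks that the fake-ball hypotheses DO supply these clauses (so PATH is not
false or vacuous for a typing reason, and the standing disprover's strengthening
`PATHWithoutFakeBall` of `Cruxes/OrigamiFoldExistence/Disproof.lean` §9 genuinely contains the
stub):

* `contDiffAt_comp_of_isSmoothEmbedding_of_isLocalDiffeomorphAt` — `F ∘ e` is `C^∞` at `u`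
  (`𝓡 4` is the self-model of `ℝ⁴`, `ContMDiffAt ↔ ContDiffAt`);
* `bijective_fderiv_comp_of_isSmoothEmbedding_of_isLocalDiffeomorphAt` — `d(F ∘ e)_u` is
  bijective (chain rule; `dF` an isomorphism at `e u`; `de_u` injective by the immersion
  criterion, hence bijective in dimension `4`);
* `contDiffAt_crease_of_fakeBall`, `bijective_fderiv_crease_of_fakeBall` — the same under the
  skeleton's exact hypotheses (`Manifold.IsSmoothEmbedding (𝓡 4) (𝓡 4) ∞ e` and
  `∀ x ∉ e '' ball 0 1, IsLocalDiffeomorphAt (𝓡 4) (𝓡 4) ∞ F x`, the two conjuncts of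
  `IsImmersedFakeBall S e F`, inlined) at every `‖u‖ = 1`.

Helper lemmas only (no Theses statement is asserted); refuter seat
`refuter-cdisprove-stmt-SmoothPoincare4-7844-g4-0`, cycle 4.
-/

noncomputable section

-- the prescribed namespace `Summit.<P>.<Sub>.…` duplicates `SmoothPoincare4` (P = Sub)
set_option linter.dupNamespace false

open scoped Manifold ContDiff Topology
open Set Function
open Literature.Topology.FourManifolds (HomotopySphere)

namespace Summit.SmoothPoincare4.SmoothPoincare4.Theorems.OrigamiFoldExistence.Negative

/-- A unit vector is not the `e`-image of a point of the open unit ball when `e` is injective.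
[folklore] -/
theorem not_mem_image_ball_of_norm_eq_one {S : Type*} {e : EuclideanSpace ℝ (Fin 4) → S}
    (he : Injective e) {u : EuclideanSpace ℝ (Fin 4)} (hu : ‖u‖ = 1) :
    e u ∉ e '' Metric.ball (0 : EuclideanSpace ℝ (Fin 4)) 1 := by
  rintro ⟨y, hy, hyu⟩
  obtain rfl : y = u := he hyu
  simp [Metric.mem_ball, dist_zero_right, hu] at hy

/-- An injective linear endomorphism of `ℝ⁴` is surjective. [folklore] -/
theorem surjective_of_injective_endo (L : EuclideanSpace ℝ (Fin 4) →ₗ[ℝ] EuclideanSpace ℝ (Fin 4))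
    (h : Injective L) : Surjective L :=
  (LinearMap.injective_iff_surjective).mp h

section Germ

variable {S : Type} [TopologicalSpace S] [ChartedSpace (EuclideanSpace ℝ (Fin 4)) S]

/-- **The crease germ is `C^∞`**: if `e : ℝ⁴ → S` is a smooth embedding and `F : S → ℝ⁴` a `C^∞`
local diffeomorphism at `e u`, then `F ∘ e` is `C^∞` at `u`. [folklore] -/
theorem contDiffAt_comp_of_isSmoothEmbedding_of_isLocalDiffeomorphAt
    {e : EuclideanSpace ℝ (Fin 4) → S} {F : S → EuclideanSpace ℝ (Fin 4)}
    {u : EuclideanSpace ℝ (Fin 4)} (he : Manifold.IsSmoothEmbedding (𝓡 4) (𝓡 4) ∞ e)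
    (hF : IsLocalDiffeomorphAt (𝓡 4) (𝓡 4) ∞ F (e u)) : ContDiffAt ℝ ∞ (F ∘ e) u :=
  contMDiffAt_iff_contDiffAt.mp (hF.contMDiffAt.comp u (he.contMDiff u))

/-- **The crease germ has bijective derivative**: with `e`, `F` as above and `S` a smooth
manifold, `d(F ∘ e)_u = dF_{e u} ∘ de_u` is bijective. [folklore] -/
theorem bijective_fderiv_comp_of_isSmoothEmbedding_of_isLocalDiffeomorphAt [IsManifold (𝓡 4) ∞ S]
    {e : EuclideanSpace ℝ (Fin 4) → S} {F : S → EuclideanSpace ℝ (Fin 4)}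
    {u : EuclideanSpace ℝ (Fin 4)} (he : Manifold.IsSmoothEmbedding (𝓡 4) (𝓡 4) ∞ e)
    (hF : IsLocalDiffeomorphAt (𝓡 4) (𝓡 4) ∞ F (e u)) : Bijective (fderiv ℝ (F ∘ e) u) := by
  have h1 : MDifferentiableAt (𝓡 4) (𝓡 4) e u := (he.contMDiff u).mdifferentiableAt (by simp)
  have h2 : MDifferentiableAt (𝓡 4) (𝓡 4) F (e u) := hF.mdifferentiableAt (by simp)
  have hcomp : mfderiv (𝓡 4) (𝓡 4) (F ∘ e) u =
      (mfderiv (𝓡 4) (𝓡 4) F (e u)).comp (mfderiv (𝓡 4) (𝓡 4) e u) :=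
    mfderiv_comp u h2 h1
  have heq : fderiv ℝ (F ∘ e) u = mfderiv (𝓡 4) (𝓡 4) (F ∘ e) u := (mfderiv_eq_fderiv).symm
  rw [heq, hcomp]
  have hFbij : Bijective (mfderiv (𝓡 4) (𝓡 4) F (e u)) :=
    (hF.mfderivToContinuousLinearEquiv (by simp)).bijective
  have heinj : Injective (mfderiv (𝓡 4) (𝓡 4) e u) :=
    Literature.Topology.FourManifolds.injective_mfderiv_of_isImmersionAt'
      (he.isImmersion.isImmersionAt u)
  have hesurj : Surjective (mfderiv (𝓡 4) (𝓡 4) e u) :=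
    surjective_of_injective_endo
      ((mfderiv (𝓡 4) (𝓡 4) e u).toLinearMap :
        EuclideanSpace ℝ (Fin 4) →ₗ[ℝ] EuclideanSpace ℝ (Fin 4)) heinj
  exact hFbij.comp ⟨heinj, hesurj⟩

end Germ

/-- **The crease germ of an immersed fake ball is `C^∞` at the unit sphere** (hypotheses: the
two conjuncts of the skeleton's `IsImmersedFakeBall S e F`). [folklore] -/
theorem contDiffAt_crease_of_fakeBall (S : HomotopySphere 4)
    {e : EuclideanSpace ℝ (Fin 4) → S.carrier} {F : S.carrier → EuclideanSpace ℝ (Fin 4)}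
    (he : Manifold.IsSmoothEmbedding (𝓡 4) (𝓡 4) ∞ e)
    (hF : ∀ x, x ∉ e '' Metric.ball (0 : EuclideanSpace ℝ (Fin 4)) 1 →
      IsLocalDiffeomorphAt (𝓡 4) (𝓡 4) ∞ F x)
    {u : EuclideanSpace ℝ (Fin 4)} (hu : ‖u‖ = 1) : ContDiffAt ℝ ∞ (F ∘ e) u :=
  contDiffAt_comp_of_isSmoothEmbedding_of_isLocalDiffeomorphAt he
    (hF _ (not_mem_image_ball_of_norm_eq_one he.isEmbedding.injective hu))

/-- **The crease germ of an immersed fake ball has bijective derivative at the unit sphere**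
(hypotheses: the two conjuncts of the skeleton's `IsImmersedFakeBall S e F`). [folklore] -/
theorem bijective_fderiv_crease_of_fakeBall (S : HomotopySphere 4)
    {e : EuclideanSpace ℝ (Fin 4) → S.carrier} {F : S.carrier → EuclideanSpace ℝ (Fin 4)}
    (he : Manifold.IsSmoothEmbedding (𝓡 4) (𝓡 4) ∞ e)
    (hF : ∀ x, x ∉ e '' Metric.ball (0 : EuclideanSpace ℝ (Fin 4)) 1 →
      IsLocalDiffeomorphAt (𝓡 4) (𝓡 4) ∞ F x)
    {u : EuclideanSpace ℝ (Fin 4)} (hu : ‖u‖ = 1) : Bijective (fderiv ℝ (F ∘ e) u) :=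
  bijective_fderiv_comp_of_isSmoothEmbedding_of_isLocalDiffeomorphAt he
    (hF _ (not_mem_image_ball_of_norm_eq_one he.isEmbedding.injective hu))

end Summit.SmoothPoincare4.SmoothPoincare4.Theorems.OrigamiFoldExistence.Negative

end
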